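import Mathlib
import Summits.ResolutionOfSingularities.ResolutionOfSingularities.Theorems.WeightedInvariantLocalWeightedDropNCResRegimeTransportLegal
import Summits.ResolutionOfSingularities.ResolutionOfSingularities.Theorems.WeightedInvariantLocalWeightedDropNCResPresentationDefs
import Summits.ResolutionOfSingularities.ResolutionOfSingularities.Theorems.WeightedInvariantLocalWeightedDropTOT2NearOld
import Summits.ResolutionOfSingularities.ResolutionOfSingularities.Theorems.WeightedInvariantLocalWeightedDropTOT2E1Presentation

/-!
# `LocalWeightedDrop`, TOT2-LINE inner S-ASM (6): READING THE LETTER REGIME (L) OFF A PRESENTATION OF THE FOLDED STATE — the unfold of a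
# presented state in the apex column is in the apex column, in good position, or in bad position (never again a single-letter directrix)

Crux item stmt-ResolutionOfSingularities-8899 `WeightedInvariant.LocalWeightedDrop` (route `ResolutionOfSingularities/WeightedInvariant`), ENGINE
skeleton v33 (35b29332b4d99231), registered stub **`stub_regimeLetter`**; TOT2-LINE v1.3 §3 (L) + STATUS 17:2xZ «(L) hand-free» (res-L1-w43-lead-1 g5).
[OURS · L1 W4.3 · chain w43 · seat res-L1-w43-lead-1 gen 5; def-free; on parts (1)/(3)/(3b)/(4) (`…NCResRegimeDefs/Transport/TransportLegal/
PresentationDefs`), res-L1-w43-stub-3's `TOT2Near.initEval_mul_prod_X` / `inv_mul_prod_X` (…TOT2NearOld), res-type-056's `TOT2E1.initEval_subst_legal` /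
`initEval_unit_mul`.  Nothing here is a statement of any manuscript; AI-produced, gate-checked, weaker than expert review.]

THE DEVICE.  A state in the letter regime (`O = ∅`, directrix = the boundary letter `x_l`) is played as the FOLDED state `δ⁺ = (f, E, {l})` (regime
(P) with the letter as history); its transforms `ε` (history `{l̃}`) are read back on the UNFOLD `U ε = (ε.f, ε.E, ∅)`.  When the (P)-play exits at
the same head because the successor label left the regime, res-L1-w43-stub-2's reader gives `HCol ε` (for the product `f′ · x_{l̃}`); this file
converts that into the (L)-exit for `U ε`:
* `Decoration.unfold` notation-free: we work with an arbitrary `υ` with `υ.f = ε.f`, `υ.E = ε.E`, `υ.O = ∅`;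
* `isDirForm_unique` — two directrix forms of one state are proportional;
* `goodDir_or_badDir_of_two_support` — (three letters) `O = ∅`, dirform `ℓ`, a letter-straightening legal `Θ`: if `ℓ ᵥ* lin Θ` has two distinct
  non-zero entries, the state is in good or bad position (a single-letter directrix would transport to a single entry);
* `initEval_monicGerm_single_last` — `in_d(y^d + Σ A_j y^j)(e_y) = 1`;
* **`hCol_or_goodDir_or_badDir_unfold`** — `ε` admissible with `O = {l}`, `2 ≤ o`, presented (`PresBy ε ε.c A Θ`, letter `l ↦ y`), `HCol ε`
  ⇒ the unfold is `HCol ∨ GoodDir ∨ BadDir`: a dirform `ℓ′` of `f′` read in `Θ`-coordinates has a non-zero `y`-entry (evaluate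
  `in_{o+1}(Θ^*(f′x_l))` at `e_y`: `U(0) · 1 = λ (ℓ′·M e_y)^o · u(0)`) and a non-zero `u`-entry (else `ℓ′ ∝ e_l`, and then `Dir(f′) ∩ {v_l = 0}` is a
  plane: `¬ HCol ε`).
-/

set_option linter.dupNamespace false -- mandated namespace of this single-conjunct summit

noncomputable section

namespace Summit.ResolutionOfSingularities.ResolutionOfSingularities.Theorems

open Literature.AlgebraicGeometry.Resolution

namespace TameFourTupleDrop

open MvPowerSeries TOT2Near

variable {k : Type} [Field k] {m : ℕ}

namespace Decoration

/-! ## Uniqueness of directrix forms -/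

/-- **TWO DIRECTRIX FORMS OF ONE STATE ARE PROPORTIONAL** (`0 < c`). -/
theorem isDirForm_unique {δ : Decoration k m} (hc : 0 < δ.c) {ℓ ℓ' : Fin (m + 1) → k} (hℓ : δ.IsDirForm ℓ) (hℓ' : δ.IsDirForm ℓ') :
    ∃ κ : k, κ ≠ 0 ∧ ∀ j, ℓ' j = κ * ℓ j := by
  obtain ⟨hℓ0, la, hla, hcone⟩ := hℓ
  obtain ⟨hℓ'0, la', hla', hcone'⟩ := hℓ'
  refine exists_smul_of_ker_le (fun u hu => ?_) hℓ'0
  have h := hcone' u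
  rw [hcone u, hu, zero_pow hc.ne', mul_zero] at h
  exact pow_eq_zero_iff hc.ne' |>.mp ((mul_eq_zero.mp h.symm).resolve_left hla')

/-! ## Two non-zero entries in straightening coordinates ⇒ good or bad position (three letters) -/

/-- **GOOD OR BAD POSITION FROM TWO ENTRIES.**  Three letters, `O = ∅`, dirform `ℓ`, `Θ` a legal change straightening every boundary letter
(`IsBPermissible δ Θ 𝟙`).  If `ℓ ᵥ* lin Θ` has two distinct non-zero entries then the state is in good or in bad position: a single-letter directrix
`e_a` (`a ∈ E`, `Θ a = u · x_{a′}`) would be proportional to `ℓ` and transport to the single entry `u(0) · e_{a′}`. -/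
theorem goodDir_or_badDir_of_two_support [Infinite k] {b : MvPowerSeries (Fin (2 + 1)) k} {δ : Decoration k 2}
    {Θ : Fin (2 + 1) → MvPowerSeries (Fin (2 + 1)) k} (hadm : Admissible b δ) (ho : 2 ≤ δ.o) (hO : δ.O = ∅) {ℓ : Fin (2 + 1) → k}
    (hℓ : δ.IsDirForm ℓ) (hperm : IsBPermissible δ Θ (fun _ => 1)) {j₁ j₂ : Fin (2 + 1)} (hj : j₁ ≠ j₂)
    (h₁ : Matrix.vecMul ℓ (Matrix.of fun a j : Fin (2 + 1) => coeff (Finsupp.single j 1) (Θ a)) j₁ ≠ 0)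
    (h₂ : Matrix.vecMul ℓ (Matrix.of fun a j : Fin (2 + 1) => coeff (Finsupp.single j 1) (Θ a)) j₂ ≠ 0) :
    δ.GoodDir ∨ δ.BadDir := by
  rcases regime_split hadm ho (not_hCol_of_isDirForm hℓ) with hne | hgood | hbad | ⟨a, haO, haE, hea⟩
  · rw [hO] at hne; exact absurd hne Finset.not_nonempty_empty
  · exact Or.inl hgood
  · exact Or.inr hbad
  · exfalso
    -- `e_a` is proportional to `ℓ`
    have hc : 0 < δ.c := by rw [c_eq_o_of_O_eq_empty hO]; omega
    obtain ⟨κ, hκ, hprop⟩ := isDirForm_unique hc hℓ hea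
    -- transport: `e_a ᵥ* M = u(0) · e_{a′}`
    obtain ⟨u, hu, he⟩ := strIdx_spec (hperm.2.2.2 a haE)
    have hrow := vecMul_single_of_straight (Φ := Θ) he
    have hsingle : (Pi.single a (1 : k) : Fin (2 + 1) → k) = κ • ℓ := by
      funext j; rw [hprop j, Pi.smul_apply, smul_eq_mul]
    rw [hsingle, Matrix.smul_vecMul] at hrow
    -- so `κ · (ℓ ᵥ* M)` is supported at `strIdx Θ a` only
    have hj₁' : j₁ = strIdx Θ a := by
      by_contra hne
      have h := congr_fun hrow j₁
      rw [Pi.smul_apply, Pi.smul_apply, smul_eq_mul, smul_eq_mul, Pi.single_eq_of_ne hne, mul_zero] at h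
      exact (mul_ne_zero hκ h₁) h
    have hj₂' : j₂ = strIdx Θ a := by
      by_contra hne
      have h := congr_fun hrow j₂
      rw [Pi.smul_apply, Pi.smul_apply, smul_eq_mul, smul_eq_mul, Pi.single_eq_of_ne hne, mul_zero] at h
      exact (mul_ne_zero hκ h₂) h
    exact hj (hj₁'.trans hj₂'.symm)

end Decoration

end TameFourTupleDrop

/-! ## The degree-`d` form of the monic germ at the `y`-direction -/

namespace NCPoly

open MvPowerSeries

variable {k : Type} [Field k]

/-- The coefficient of `y^d` in `y^d + Σ_{j<d} A_j(u) y^j` is `1`. -/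
theorem coeff_single_last_monicGerm (d : ℕ) (A : Fin d → MvPowerSeries (Fin 2) k) :
    coeff (Finsupp.single (Fin.last 2) d) (monicGerm d A) = 1 := by
  classical
  unfold monicGerm
  rw [map_add, coeff_X_pow, if_pos rfl, map_sum, Finset.sum_eq_zero, add_zero]
  intro j _
  -- `rename(A_j) · y^j` has no `y^d` term: `y`-degree of every monomial is `j < d` plus a `y`-free exponent
  rw [X_pow_eq, coeff_mul_monomial, mul_one]
  split_ifs with hle
  · rw [MvPowerSeries.coeff_rename_eq_zero]
    rintro ⟨e, he⟩
    -- `mapDomain succAbove e` vanishes at `last`, but the target exponent has `last`-entry `d - j > 0`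
    have h := congr_arg (fun x => x (Fin.last 2)) he
    simp only [Finsupp.tsub_apply, Finsupp.single_eq_same] at h
    rw [Finsupp.mapDomain_notin_range] at h
    · have hj := j.2; omega
    · rintro ⟨i, hi⟩; exact absurd hi (Fin.succAbove_ne _ _)
  · rfl

/-- **`in_d(y^d + Σ A_j y^j)(e_y) = 1`.** -/
theorem initEval_monicGerm_single_last (d : ℕ) (A : Fin d → MvPowerSeries (Fin 2) k) :
    CobordantChart.initEval (fun _ : Fin 3 => 1) (Pi.single (Fin.last 2) 1) d (monicGerm d A) = 1 := by
  classical
  rw [ApexFreeOrderDrop.initEval_one_eq_sum]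
  rw [Finset.sum_eq_single (Finsupp.single (Fin.last 2) d)]
  · rw [coeff_single_last_monicGerm, one_mul, Finset.prod_eq_single (Fin.last 2)]
    · rw [Pi.single_eq_same, one_pow]
    · intro i _ hi
      rw [Finsupp.single_eq_of_ne hi, pow_zero]
    · intro h; exact absurd (Finset.mem_univ _) h
  · intro e he hne
    -- some coordinate `i ≠ last` has `e i ≠ 0`, so the monomial `∏ (e_y)_i^{e_i}` vanishes
    obtain ⟨i, hi, hei⟩ : ∃ i, i ≠ Fin.last 2 ∧ e i ≠ 0 := by
      by_contra hall
      push Not at hall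
      apply hne
      have hed : e.degree = d := by
        rw [← ApexFreeOrderDrop.weight_one_eq_degree]
        exact (ApexFreeOrderDrop.mem_antidiag_iff d e).mp he
      ext i
      by_cases hil : i = Fin.last 2
      · subst hil
        rw [Finsupp.single_eq_same]
        have hsum : e.degree = e (Fin.last 2) := by
          rw [Finsupp.degree_eq_sum, Fin.sum_univ_castSucc]
          rw [Finset.sum_eq_zero (fun i _ => hall _ (Fin.castSucc_lt_last i).ne), zero_add]
        rw [← hsum, hed]
      · rw [Finsupp.single_eq_of_ne hil]; exact hall i hil
    apply mul_eq_zero_of_right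
    exact Finset.prod_eq_zero (Finset.mem_univ i) (by rw [Pi.single_eq_of_ne hi, zero_pow hei])
  · intro h; exact absurd ((ApexFreeOrderDrop.mem_antidiag_iff d _).mpr (by
      rw [ApexFreeOrderDrop.weight_one_eq_degree, Finsupp.degree_single])) h

end NCPoly

/-! ## The unfold of a presented folded state -/

namespace TameFourTupleDrop

open MvPowerSeries TOT2Near

variable {k : Type} [Field k]

namespace Decoration

/-- **THE (L)-EXIT READ OFF A PRESENTATION.**  Three letters.  `ε` an admissible decoration of `b` with history ONE letter `O = {l}` and `2 ≤ o`,
PRESENTED (`PresBy ε ε.c A N Θ`: `Θ` straightens every letter, `l ↦ y`, `Θ^*(f · x_l) = U · (y^d + Σ A_j y^j)`), and in the apex column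
(`HCol ε`, i.e. `e(f · x_l) ≤ 1` — what the exit reader of the (P)-play delivers when the successor label left the regime).  Then the UNFOLD
`υ = (ε.f, ε.E, ∅)` — any decoration with the same equation and boundary and empty history — is in the apex column, in good position, or in bad
position. -/
theorem hCol_or_goodDir_or_badDir_unfold [Infinite k] {b : MvPowerSeries (Fin (2 + 1)) k} {ε υ : Decoration k 2} (hadm : Admissible b ε)
    (ho : 2 ≤ ε.o) {l : Fin (2 + 1)} (hO : ε.O = {l}) {d : ℕ} (hd : ε.c = d) {A : Fin d → MvPowerSeries (Fin 2) k} {N : Finset (Fin 2)}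
    {Θ : Fin (2 + 1) → MvPowerSeries (Fin (2 + 1)) k} (hpres : ε.PresBy d A N Θ) (hcol : ε.HCol)
    (hυf : υ.f = ε.f) (hυE : υ.E = ε.E) (hυO : υ.O = ∅) :
    υ.HCol ∨ υ.GoodDir ∨ υ.BadDir := by
  classical
  by_cases hυcol : υ.HCol
  · exact Or.inl hυcol
  right
  -- the unfold is admissible for the same germ and has the same order
  have hadmυ : Admissible b υ := by
    obtain ⟨h1, h2, h3⟩ := hadm
    refine ⟨?_, ?_, ?_⟩
    · simpa [Decoration.total, hυf, hυE] using h1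
    · rw [hυf]; exact h2
    · rw [hυf, hυE]; exact h3
  have hoυ : υ.o = ε.o := by rw [Decoration.o, Decoration.o, hυf]
  have hoυ2 : 2 ≤ υ.o := by rw [hoυ]; exact ho
  obtain ⟨ℓ, hℓ⟩ := exists_isDirForm_of_not_hCol hadmυ hoυ2 hυcol
  obtain ⟨hperm, hOlast, -, -, U, hU, hP⟩ := hpres
  set M := (Matrix.of fun a j : Fin (2 + 1) => coeff (Finsupp.single j 1) (Θ a)) with hM
  -- the letter `l` is straightened to `y`
  have hlE : l ∈ ε.E := ε.O_subset (by rw [hO]; exact Finset.mem_singleton_self l)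
  have hl_last : strIdx Θ l = Fin.last 2 := hOlast l (by rw [hO]; exact Finset.mem_singleton_self l)
  obtain ⟨u, hu, he⟩ := strIdx_spec (hperm.2.2.2 l hlE)
  rw [hl_last] at he
  -- B-permissibility of `Θ` for the unfold (point move: (P2) is about the order of `Θ l`, the same letters)
  have hpermυ : IsBPermissible υ Θ (fun _ => 1) := by
    refine ⟨hperm.1, ?_, ?_, ?_⟩
    · rw [hυf]; exact hperm.2.1
    · intro l' hl'; rw [hυO] at hl'; exact absurd hl' (Finset.notMem_empty _)
    · rw [hυE]; exact hperm.2.2.2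
  -- the dirform of `f` in the original letters, at degree `o`
  have hconeℓ : ∃ la : k, la ≠ 0 ∧ ∀ w : Fin (2 + 1) → k,
      CobordantChart.initEval (fun _ : Fin (2 + 1) => 1) w ε.o ε.f = la * dotProduct ℓ w ^ ε.o := by
    obtain ⟨-, la, hla, hc⟩ := hℓ
    refine ⟨la, hla, fun w => ?_⟩
    have h := hc w
    rwa [hυO, Finset.prod_empty, mul_one, hυf, c_eq_o_of_O_eq_empty hυO, hoυ] at h
  obtain ⟨la, hla, hcone⟩ := hconeℓ
  -- (A1) the `y`-entry of `ℓ ᵥ* M` is non-zero: evaluate `in_{o+1}(Θ^*(f · x_l))` at `e_y`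
  have hc1 : ε.c = ε.o + 1 := by rw [Decoration.c, hO, Finset.card_singleton]
  have hprod : ε.f * ∏ l' ∈ ε.O, (X l' : MvPowerSeries (Fin (2 + 1)) k) = ε.f * X l := by rw [hO, Finset.prod_singleton]
  have hordprod : (ε.f * X l).order = ((ε.o + 1 : ℕ) : ℕ∞) := by
    rw [← hprod, Decoration.order_totalO hadm, hc1]
  have hordP : (NCPoly.monicGerm d A).order = ((ε.o + 1 : ℕ) : ℕ∞) := by
    have h := TOT2E1.order_subst_eq_of_legal Θ hperm.1.1 hperm.1.2.1 (ε.f * X l)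
    rw [hprod] at hP
    rw [hP, TOT2E1.order_unit_mul U _ hU, hordprod] at h
    exact h
  have hylast : Matrix.vecMul ℓ M (Fin.last 2) ≠ 0 := by
    have hdeq : ε.o + 1 = d := by omega
    have h1 : CobordantChart.initEval (fun _ : Fin 3 => 1) (Pi.single (Fin.last 2) 1) (ε.o + 1) (NCPoly.monicGerm d A) = 1 := by
      rw [hdeq]; exact NCPoly.initEval_monicGerm_single_last d A
    -- read `in_{o+1}(Θ^*(f·x_l))` at `e_y` through `Θ`
    have hread := TOT2E1.initEval_subst_legal Θ hperm.1.1 hperm.1.2.1 (ε.f * X l) hordprod (Pi.single (Fin.last 2) 1)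
    rw [hprod] at hP
    rw [hP, TOT2E1.initEval_unit_mul U _ hordP.symm.le, h1, mul_one] at hread
    -- RHS: `in_o(f)(M e_y) · (M e_y)_l`
    rw [TOT2Near.initEval_mul_X, hcone] at hread
    have hMl : M.mulVec (Pi.single (Fin.last 2) 1) l = constantCoeff u := by
      rw [Matrix.mulVec_single_one]
      change coeff (Finsupp.single (Fin.last 2) 1) (Θ l) = _
      rw [row_linMat_of_straight he, if_pos rfl, mul_one]
    rw [hMl, Matrix.dotProduct_mulVec, dotProduct_single_one] at hread
    intro h0
    rw [h0, zero_pow (by omega : ε.o ≠ 0), mul_zero, zero_mul] at hread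
    exact hU hread
  -- (A2) some `u`-entry is non-zero: otherwise `ℓ ∝ e_l` and `Dir(f) ∩ {v_l = 0}` is a plane, against `HCol ε`
  have hother : ∃ j, j ≠ Fin.last 2 ∧ Matrix.vecMul ℓ M j ≠ 0 := by
    by_contra hall
    push Not at hall
    -- `ℓ ᵥ* M = α e_y = (α / u(0)) · (e_l ᵥ* M)`, so `ℓ = (α/u(0)) e_l`
    set α := Matrix.vecMul ℓ M (Fin.last 2) with hα
    have hrow : Matrix.vecMul (Pi.single l 1) M = constantCoeff u • Pi.single (Fin.last 2) 1 := vecMul_single_of_straight he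
    have hvec : Matrix.vecMul ℓ M = Matrix.vecMul ((α / constantCoeff u) • Pi.single l 1) M := by
      rw [Matrix.smul_vecMul, hrow, smul_smul, div_mul_cancel₀ _ hu]
      funext j
      by_cases hj : j = Fin.last 2
      · subst hj; rw [Pi.smul_apply, Pi.single_eq_same, smul_eq_mul, mul_one]
      · rw [hall j hj, Pi.smul_apply, Pi.single_eq_of_ne hj, smul_zero]
    have hℓeq : ℓ = (α / constantCoeff u) • Pi.single l 1 := by
      by_contra hne
      have h0 : Matrix.vecMul (ℓ - (α / constantCoeff u) • Pi.single l 1) M = 0 := by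
        rw [Matrix.sub_vecMul, hvec, sub_self]
      exact vecMul_ne_zero_of_isUnit_det hperm.1.2.1 (sub_ne_zero.mpr hne) h0
    -- two independent invariance vectors of `in(f · x_l)`: `e_a` for the two indices `a ≠ l`
    have hinv : ∀ a : Fin (2 + 1), a ≠ l → ε.IsInv (Pi.single a 1) := by
      intro a ha v
      have hdot : dotProduct ℓ (Pi.single a 1) = 0 := by
        rw [hℓeq, smul_dotProduct, dotProduct_single_one, Pi.single_eq_of_ne ha, smul_zero]
      have hinvf := isInv_of_isDirForm hℓ hdot
      -- `IsInv` for `υ` is about `in_o f`; transport to the product `f · x_l` at degree `o + 1`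
      unfold Decoration.IsInv at hinvf
      rw [hυO, Finset.prod_empty, mul_one, hυf, c_eq_o_of_O_eq_empty hυO, hoυ] at hinvf
      rw [hprod, hc1]
      have h := TOT2Near.inv_mul_prod_X (o := ε.o) (f := ε.f) (u := Pi.single a 1) {l} hinvf
        (fun l' hl' => by rw [Finset.mem_singleton] at hl'; rw [hl', Pi.single_eq_of_ne (Ne.symm ha)]) v
      rwa [Finset.card_singleton, Finset.prod_singleton] at h
    obtain ⟨a₁, ha₁⟩ : ∃ a₁ : Fin (2 + 1), a₁ ≠ l := ⟨l + 1, by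
      intro h; have := congrArg Fin.val h; simp [Fin.val_add] at this; omega⟩
    obtain ⟨a₂, ha₂l, ha₂⟩ : ∃ a₂ : Fin (2 + 1), a₂ ≠ l ∧ a₂ ≠ a₁ := by
      have : ∀ x y : Fin 3, ∃ z : Fin 3, z ≠ x ∧ z ≠ y := by decide
      exact this l a₁
    obtain ⟨β₁, β₂, hβ, hrel⟩ := hcol _ _ (hinv a₁ ha₁) (hinv a₂ ha₂l)
    have h1 := congr_fun hrel a₁
    have h2 := congr_fun hrel a₂
    simp only [Pi.add_apply, Pi.smul_apply, Pi.single_eq_same, Pi.single_eq_of_ne ha₂.symm, Pi.single_eq_of_ne ha₂, smul_eq_mul, mul_one,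
      mul_zero, add_zero, zero_add, Pi.zero_apply] at h1 h2
    rcases hβ with hβ₁ | hβ₂
    · exact hβ₁ h1
    · exact hβ₂ h2
  obtain ⟨j, hj, hj0⟩ := hother
  exact goodDir_or_badDir_of_two_support hadmυ hoυ2 hυO hℓ hpermυ hj hj0 hylast

end Decoration

end TameFourTupleDrop

end Summit.ResolutionOfSingularities.ResolutionOfSingularities.Theorems

end
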